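import Literature.InformationTheory.QuantumCodes.ToricCodePhenomenological
import Literature.InformationTheory.QuantumCodes.IrreducibleCountingThreshold
import Literature.InformationTheory.QuantumCodes.ToricCodeCycles
import Mathlib.Analysis.SpecificLimits.Basic
import HarnessLib

/-!
# An unconditional threshold for the toric code with noisy syndrome measurement (`q = p`):
# `100 p(1-p) < 1` for every minimum-weight space-time decoder, by irreducible-cluster counting

Topic `Literature/InformationTheory/QuantumCodes` (venture QEC, LADDER-QEC rung Q5, phenomenological row;
qec-lit-2). PROVED, no named fact, kernel axioms. The statement file `ToricCodePhenomenological.lean`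
(qec-type-09) types the Dennis–Kitaev–Landahl–Preskill space-time decoding problem of the `L × L` toric
code monitored for `T` noisy rounds (`stMatrix`, `stSyn`, `stCycles`, `stTrivial`, `phenomFailureProb`) and the
PARAMETRIC counting-bound threshold `phenomThreshold_of_sawCountBound` (hypothesis: a bound `cₙ(ℤ³) ≤ C νⁿ` on
cubic self-avoiding walks) as a named fact, whose elementary instance is `ν = 5` (`c_{n+1} ≤ 6·5ⁿ`):
threshold `4·25·p(1-p) < 1`, `p < (5-2√6)/10 ≈ .0101`. This file PROVES that elementary instance
UNCONDITIONALLY — not through self-avoiding polygons of the space-time lattice (the discharge of the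
parametric fact, which needs the 3D port of `ToricCodePolygons.lean`), but through the Dumer–Kovalev–Pryadko
irreducible-cluster count of `IrreducibleClusters.lean` / `IrreducibleCountingThreshold.lean` (DKP15 Thm. 2
at `y = 0`, Thm. 3 mechanism: "With the surface codes, decoding corresponds to minimal-weight matching of
chains in three dimensions … the net effect is equivalent to increasing the weights of stabilizer generators
… by two, `w → w + 2`", p. 5): every space-time site meets at most `4 + 2 = 6` links (`card_rowSupp_stMatrix_le`),
so the irreducible space-time cycles with `m` links number at most `n_ST · 5^{m-1}`; a failing history `E`
(for a minimum-weight decoder `E'`) contains, inside `E + E'`, an irreducible space-time cycle `U` whose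
projection is homologically non-trivial and at least half of whose links are faulty
(`exists_irreducible_of_minWeight_not_corrects`, the generic form of DKP15's bad events `ℬ(U)`), and such a
`U` has at least `L` links because its projection `Π(U)` is a non-trivial cycle of the toric code
(`proj_mem_cycles`, `hammingNorm_proj_le`, `ToricCode.cycle_weight_ge_holds`: DKLP "at least `L` horizontal
links"). Hence (`phenomFailureProb_le_cluster`)
`Prob_fail ≤ n_ST · r^L / (5 (1 - r))`, `r = 10 √(p(1-p))`, `n_ST = 3L²T` space-time links, and
(`phenomThreshold_cluster`) `Prob_fail → 0` for every polynomially bounded schedule `T(L)`, every family of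
minimum-weight space-time decoders and every `0 ≤ p ≤ 1/2` with `100 p(1-p) < 1` — the SAME number as the
`ν = 5` instance of the named fact (`Summits/…/ToricCodePhenomenologicalThresholds.lean`,
`phenomThreshold_elementary`, there CONDITIONAL on `h : phenomThreshold_of_sawCountBound`), here with no
hypothesis. The sharper tiers (`ν > 4.76` native, `ν > 4.7387` conditional on Pönitz–Tittmann) still require
the parametric fact. Generic by-products (any check matrix over any finite index types):
`card_le_two_mul_card_inter_of_minWeight'` (half-weight lemma), `exists_irreducible_of_minWeight_not_corrects`,
`sum_not_corrects_bernoulli_le_of_rowWeight` (the `Decoder.IsMinWeight` form of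
`sum_decodingFails_bernoulli_le_of_rowWeight`).

## References

* [DennisEtAl2002] E. Dennis, A. Kitaev, A. Landahl, J. Preskill, J. Math. Phys. 43 (2002) 4452,
  arXiv:quant-ph/0110143: §4.2–4.3 (space-time lattice, `∂`, success iff `E + E'` homologically trivial),
  §5.2 ("at least `L` horizontal links", eq. (e_ineq)), §5.3 eqs. (saw_d) at `d = 3`, (threshold_iso),
  (fail_iso) — via the tree's `ToricCodePhenomenological.lean`.
* [DumerKovalevPryadko2015] I. Dumer, A. A. Kovalev, L. P. Pryadko, PRL 115 (2015) 050502, arXiv:1412.6172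
  (held `paper:arxiv-1412.6172`): Thm. 2 (`y = 0`), Thm. 3 and p. 5 "`w → w + 2`" for syndrome errors
  (chunk p0006 L15–21), eq. (upper-bound-Nm-CSS), Lemma 4.
-/

namespace Literature.InformationTheory.QuantumCodes

open Finset Matrix Filter Topology

/-! ### Generic: minimum-weight failure forces a half-faulty irreducible operator (any index types) -/

section Generic

variable {ι V : Type*} [Fintype V] [DecidableEq V]

omit [DecidableEq V] in
/-- Membership in the support. [folklore] -/
private theorem mem_supp_iff' {x : V → ZMod 2} {v : V} : v ∈ supp x ↔ x v ≠ 0 := by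
  simp [supp]

/-- In `𝔽₂`, a non-zero element is `1`. [folklore] -/
private theorem zmod2_eq_one_of_ne_zero' {a : ZMod 2} (h : a ≠ 0) : a = 1 := by
  revert a; decide

/-- **The half-weight lemma, generic index types** (DKLP eq. (e_ineq); Gottesman 2014 "`wt E|_S ≤ wt F|_S`";
DKP15 "`U` does not increase the energy of the original error"): if `e'` is a minimum-weight vector with the
syndrome of `e`, and `W ⊆ supp (e + e')` is undetectable (`H 𝟙_W = 0`), then at least half of `W` lies in
`supp e`: `|W| ≤ 2 |W ∩ supp e|` — compare `e'` with `e' + 𝟙_W`, which has the same syndrome.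
[cite: DumerKovalevPryadko2015, eq. (min-E-condition) (ε(UE) ≤ ε(E))] -/
theorem card_le_two_mul_card_inter_of_minWeight' (H : Matrix ι V (ZMod 2)) {e e' : V → ZMod 2}
    (hsyn : H *ᵥ e' = H *ᵥ e)
    (hmin : ∀ x : V → ZMod 2, H *ᵥ x = H *ᵥ e → hammingNorm e' ≤ hammingNorm x)
    {W : Finset V} (hW : W ⊆ supp (e + e')) (hWu : IsUndetectable H W) :
    W.card ≤ 2 * (W ∩ supp e).card := by
  classical
  set x : V → ZMod 2 := e' + vecOf W with hx
  have hsynx : H *ᵥ x = H *ᵥ e := by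
    rw [hx, Matrix.mulVec_add, hsyn]
    unfold IsUndetectable at hWu
    rw [hWu, add_zero]
  have hle : hammingNorm e' ≤ hammingNorm x := hmin x hsynx
  have hn1 : hammingNorm e' = (supp e').card := rfl
  have hn2 : hammingNorm x = (supp x).card := rfl
  rw [hn1, hn2] at hle
  -- the support of `x`: outside `W` it is that of `e'`, inside `W` it is the complement of that of `e'`
  have hsuppx : supp x = (supp e' \ W) ∪ (W \ supp e') := by
    ext v
    rw [mem_union, Finset.mem_sdiff, Finset.mem_sdiff, mem_supp_iff', mem_supp_iff', hx, Pi.add_apply]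
    by_cases hv : v ∈ W
    · rw [vecOf_apply_of_mem hv]
      constructor
      · intro h
        right
        refine ⟨hv, fun h1 => ?_⟩
        rw [zmod2_eq_one_of_ne_zero' h1] at h
        exact h (by decide)
      · rintro (⟨-, h2⟩ | ⟨-, h2⟩)
        · exact (h2 hv).elim
        · intro h
          apply h2
          intro h0
          rw [h0, zero_add] at h
          exact one_ne_zero h
    · rw [vecOf_apply_of_not_mem hv, add_zero]
      constructor
      · intro h
        exact Or.inl ⟨h, hv⟩
      · rintro (⟨h1, -⟩ | ⟨h1, -⟩)
        · exact h1
        · exact (hv h1).elim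
  have hdisj : Disjoint (supp e' \ W) (W \ supp e') := by
    rw [Finset.disjoint_left]
    intro v h1 h2
    exact (Finset.mem_sdiff.1 h1).2 (Finset.mem_sdiff.1 h2).1
  have hcardx : (supp x).card = (supp e' \ W).card + (W \ supp e').card := by
    rw [hsuppx, card_union_of_disjoint hdisj]
  have hsd : (supp e' \ W).card + (supp e' ∩ W).card = (supp e').card := card_sdiff_add_card_inter _ _
  -- hence `|supp e' ∩ W| ≤ |W \ supp e'|`
  have hkey : (supp e' ∩ W).card ≤ (W \ supp e').card := by omega
  -- on `W ⊆ supp (e + e')` exactly one of `e v`, `e' v` is non-zero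
  have hone : ∀ v ∈ W, e v = 0 ↔ e' v ≠ 0 := by
    intro v hv
    have h := mem_supp_iff'.1 (hW hv)
    rw [Pi.add_apply] at h
    constructor
    · intro h0 h1
      rw [h0, h1, add_zero] at h
      exact h rfl
    · intro h1
      by_contra h0
      rw [zmod2_eq_one_of_ne_zero' h0, zmod2_eq_one_of_ne_zero' h1] at h
      exact h (by decide)
  have hsub1 : W \ supp e ⊆ supp e' ∩ W := by
    intro v hv
    rw [Finset.mem_sdiff, mem_supp_iff', not_not] at hv
    exact mem_inter.2 ⟨mem_supp_iff'.2 ((hone v hv.1).1 hv.2), hv.1⟩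
  have hsub2 : W \ supp e' ⊆ W ∩ supp e := by
    intro v hv
    rw [Finset.mem_sdiff, mem_supp_iff', not_not] at hv
    refine mem_inter.2 ⟨hv.1, mem_supp_iff'.2 fun h0 => ?_⟩
    exact ((hone v hv.1).1 h0) hv.2
  have hsplit : W.card = (W ∩ supp e).card + (W \ supp e).card := by
    rw [← card_sdiff_add_card_inter W (supp e), add_comm]
  have h1 := card_le_card hsub1
  have h2 := card_le_card hsub2
  omega

/-- **DKP15's failure criterion, `Decoder.IsMinWeight` form, any index types**: if a minimum-weight decoder
for the checks `H` (syndrome map `e ↦ H e`, undetectable errors `ker H`) fails on `e` — the net error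
`D(He) + e` is not in the trivial subspace `SX` — then some irreducible undetectable `U` with `𝟙_U ∉ SX`
satisfies `|U| ≤ 2 |U ∩ supp e|`. [cite: DumerKovalevPryadko2015, eq. (min-E-condition) (bad events ℬ(U))] -/
theorem exists_irreducible_of_minWeight_not_corrects (H : Matrix ι V (ZMod 2))
    (SX : Submodule (ZMod 2) (V → ZMod 2)) {D : Decoder (ι → ZMod 2) (V → ZMod 2)}
    (hD : D.IsMinWeight (fun e => H *ᵥ e) {x | H *ᵥ x = 0} hammingNorm) {e : V → ZMod 2}
    (hfail : ¬ D.Corrects (fun e => H *ᵥ e) (SX : Set (V → ZMod 2)) e) :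
    ∃ W : Finset V, IsIrreducible H W ∧ vecOf W ∉ SX ∧ W.card ≤ 2 * (W ∩ supp e).card := by
  classical
  have hx : H *ᵥ (D (H *ᵥ e) + e) = 0 := hD.add_mem e
  have hxS : D (H *ᵥ e) + e ∉ SX := hfail
  have hsyn : H *ᵥ D (H *ᵥ e) = H *ᵥ e := by
    rw [Matrix.mulVec_add] at hx
    funext i
    have hi := congrFun hx i
    rw [Pi.add_apply, Pi.zero_apply] at hi
    have key : ∀ a b : ZMod 2, a + b = 0 → a = b := by decide
    exact key _ _ hi
  have hmin : ∀ y : V → ZMod 2, H *ᵥ y = H *ᵥ e → hammingNorm (D (H *ᵥ e)) ≤ hammingNorm y := by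
    intro y hy
    have h1 := hD.weight_le y
    rw [hy] at h1
    exact h1
  obtain ⟨W, hWsub, hirr, hWS⟩ := exists_irreducible_of_mulVec_eq_zero H SX hx hxS
  refine ⟨W, hirr, hWS, ?_⟩
  have hW' : W ⊆ supp (e + D (H *ᵥ e)) := by rwa [add_comm]
  exact card_le_two_mul_card_inter_of_minWeight' H hsyn hmin hW' hirr.undetectable

/-- A binary vector is determined by its support. [cite: DennisEtAl2002, §4.4 (n_E(ℓ) ∈ {0,1})] -/
private theorem supp_injective' : Function.Injective (supp : (V → ZMod 2) → Finset V) := by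
  intro e₁ e₂ h
  rw [← vecOf_supp e₁, ← vecOf_supp e₂, h]

/-- **Counting-bound threshold with the irreducible-cluster constant, `Decoder.IsMinWeight` form, any index
types, independent errors**: checks of weight `≤ w` (`w ≥ 2`), `1 ≤ d ≤ ‖x‖` for all `x ∈ ker H ∖ SX`, a
minimum-weight decoder, `0 ≤ p ≤ 1/2`, `r := 2(w-1)√(p(1-p)) < 1`:
`Σ_{e : D fails on e} p^{|e|}(1-p)^{|V|-|e|} ≤ |V| r^d / ((w-1)(1-r))`.
[cite: DumerKovalevPryadko2015, Thm 2 (y = 0)] -/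
theorem sum_not_corrects_bernoulli_le_of_rowWeight (H : Matrix ι V (ZMod 2))
    (SX : Submodule (ZMod 2) (V → ZMod 2)) {D : Decoder (ι → ZMod 2) (V → ZMod 2)}
    (hD : D.IsMinWeight (fun e => H *ᵥ e) {x | H *ᵥ x = 0} hammingNorm)
    [DecidablePred fun e : V → ZMod 2 => ¬ D.Corrects (fun e => H *ᵥ e) (SX : Set (V → ZMod 2)) e]
    {w : ℕ} (hw : 2 ≤ w) (hrow : ∀ i, (rowSupp H i).card ≤ w) {d : ℕ} (hd1 : 1 ≤ d)
    (hd : ∀ x : V → ZMod 2, H *ᵥ x = 0 → x ∉ SX → d ≤ hammingNorm x)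
    {p : ℝ} (hp0 : 0 ≤ p) (hp : p ≤ 1 / 2)
    (hr : 2 * ((w - 1 : ℕ) : ℝ) * Real.sqrt (p * (1 - p)) < 1) :
    ∑ e ∈ univ.filter (fun e : V → ZMod 2 => ¬ D.Corrects (fun e => H *ᵥ e) (SX : Set (V → ZMod 2)) e),
        bernoulliWeight p (supp e) ≤
      (Fintype.card V : ℝ) * (2 * ((w - 1 : ℕ) : ℝ) * Real.sqrt (p * (1 - p))) ^ d /
        (((w - 1 : ℕ) : ℝ) * (1 - 2 * ((w - 1 : ℕ) : ℝ) * Real.sqrt (p * (1 - p)))) := by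
  classical
  set θ : ℝ := 2 * Real.sqrt (p * (1 - p)) with hθ
  have hθ0 : 0 ≤ θ := by positivity
  have hr' : ((w - 1 : ℕ) : ℝ) * θ < 1 := by rw [hθ]; linarith
  set F := univ.filter (fun e : V → ZMod 2 => ¬ D.Corrects (fun e => H *ᵥ e) (SX : Set (V → ZMod 2)) e)
    with hF
  have hsum : ∑ e ∈ F, bernoulliWeight p (supp e) = ∑ E ∈ F.image supp, bernoulliWeight p E :=
    (Finset.sum_image fun e₁ _ e₂ _ h => supp_injective' h).symm
  rw [hsum]
  set Ps : Finset (Finset V) := univ.filter (fun W => IsIrreducible H W ∧ d ≤ W.card) with hPs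
  have hcover : ∀ E ∈ F.image supp, ∃ W ∈ Ps,
      ((fun W : Finset V => W) W).card ≤ 2 * ((fun W : Finset V => W) W ∩ E).card := by
    intro E hE
    obtain ⟨e, he, rfl⟩ := Finset.mem_image.1 hE
    rw [hF, mem_filter] at he
    obtain ⟨W, hirr, hWS, hhalf⟩ := exists_irreducible_of_minWeight_not_corrects H SX hD he.2
    refine ⟨W, ?_, hhalf⟩
    rw [hPs, mem_filter]
    exact ⟨mem_univ _, hirr, hirr.le_card hd hWS⟩
  have h1 := sum_bernoulliWeight_le_of_cover hp0 hp Ps (fun W : Finset V => W) _ hcover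
  have h2 := sum_pow_card_irreducible_le H hw hrow hd1 hθ0 hr'
  have h3 : ((w - 1 : ℕ) : ℝ) * θ = 2 * ((w - 1 : ℕ) : ℝ) * Real.sqrt (p * (1 - p)) := by rw [hθ]; ring
  rw [h3] at h2
  exact h1.trans h2

end Generic

/-! ### The space-time complex of the toric code: check weights, projection, distance -/

namespace ToricCode

open Literature.Probability.LatticeModels (TorusSite)

variable {L T : ℕ} [NeZero L]

omit [NeZero L] in
/-- An entry of the star matrix is non-zero only at the four link slots of the site.
[cite: DennisEtAl2002, §3.1 (X_s = ⊗_{ℓ ∋ s} X_ℓ, four links)] -/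
private theorem starMatrix_ne_zero_imp (s : Vertex L) (ℓ : Edge L) (h : starMatrix L s ℓ ≠ 0) :
    ℓ ∈ ({(s, 0), (s, 1), (s - dir 0, 0), (s - dir 1, 1)} : Finset (Edge L)) := by
  simp only [Finset.mem_insert, Finset.mem_singleton]
  by_contra hne
  push Not at hne
  apply h
  change starRow s ℓ = 0
  simp only [starRow, Pi.add_apply, Pi.single_apply]
  rw [if_neg hne.1, if_neg hne.2.1, if_neg hne.2.2.1, if_neg hne.2.2.2]
  simp

/-- **Every space-time site meets at most `6` links**: the (at most) four links of its slice at the site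
and the two vertical links below and above it — the row weight of the space-time boundary matrix is
`≤ 4 + 2` ("equivalent to increasing the weights of stabilizer generators … by two, `w → w + 2`").
[cite: DumerKovalevPryadko2015, p. 5 (w → w + 2 for syndrome errors)] -/
theorem card_rowSupp_stMatrix_le (x : STSite L T) : (rowSupp (stMatrix L T) x).card ≤ 6 := by
  classical
  set A : Finset (Edge L) := {(x.1, 0), (x.1, 1), (x.1 - dir 0, 0), (x.1 - dir 1, 1)} with hA
  set Th : Finset (Fin T) := univ.filter (fun t : Fin T => x.2 = t.castSucc) with hTh
  set Tv : Finset (Fin T) := univ.filter (fun t : Fin T => x.2 = t.castSucc ∨ x.2 = t.succ) with hTv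
  have hsub : rowSupp (stMatrix L T) x ⊆
      (A ×ˢ Th).map ⟨Sum.inl, Sum.inl_injective⟩ ∪ (({x.1} : Finset (Vertex L)) ×ˢ Tv).map
        ⟨Sum.inr, Sum.inr_injective⟩ := by
    intro ℓ hℓ
    simp only [rowSupp, mem_filter, mem_univ, true_and] at hℓ
    rw [mem_union, Finset.mem_map, Finset.mem_map]
    rcases ℓ with ⟨e, t⟩ | ⟨s, t⟩
    · left
      simp only [stMatrix, Matrix.of_apply, Sum.elim_inl] at hℓ
      by_cases ht : x.2 = t.castSucc
      · rw [if_pos ht] at hℓ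
        refine ⟨(e, t), ?_, rfl⟩
        rw [mem_product]
        refine ⟨starMatrix_ne_zero_imp x.1 e hℓ, ?_⟩
        rw [hTh, mem_filter]
        exact ⟨mem_univ _, ht⟩
      · rw [if_neg ht] at hℓ
        exact (hℓ rfl).elim
    · right
      simp only [stMatrix, Matrix.of_apply, Sum.elim_inr] at hℓ
      by_cases hc : x.1 = s ∧ (x.2 = t.castSucc ∨ x.2 = t.succ)
      · refine ⟨(s, t), ?_, rfl⟩
        rw [mem_product, mem_singleton]
        refine ⟨hc.1.symm, ?_⟩
        rw [hTv, mem_filter]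
        exact ⟨mem_univ _, hc.2⟩
      · rw [if_neg hc] at hℓ
        exact (hℓ rfl).elim
  have hA4 : A.card ≤ 4 := by
    rw [hA]
    refine (card_insert_le _ _).trans ?_
    refine Nat.succ_le_succ ((card_insert_le _ _).trans ?_)
    refine Nat.succ_le_succ ((card_insert_le _ _).trans ?_)
    rw [card_singleton]
  have hTh1 : Th.card ≤ 1 := by
    rw [Finset.card_le_one]
    intro a ha b hb
    rw [hTh, mem_filter] at ha hb
    exact Fin.castSucc_injective _ (ha.2.symm.trans hb.2)
  have hTv2 : Tv.card ≤ 2 := by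
    have hsplit : Tv = univ.filter (fun t : Fin T => x.2 = t.castSucc) ∪
        univ.filter (fun t : Fin T => x.2 = t.succ) := by
      rw [hTv]
      exact Finset.filter_or _ _ _
    have h1 : (univ.filter (fun t : Fin T => x.2 = t.succ)).card ≤ 1 := by
      rw [Finset.card_le_one]
      intro a ha b hb
      rw [mem_filter] at ha hb
      exact Fin.succ_injective _ (ha.2.symm.trans hb.2)
    rw [hsplit]
    refine (card_union_le _ _).trans ?_
    have h0 : (univ.filter (fun t : Fin T => x.2 = t.castSucc)).card ≤ 1 := hTh1
    omega
  calc (rowSupp (stMatrix L T) x).card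
      ≤ ((A ×ˢ Th).map ⟨Sum.inl, Sum.inl_injective⟩ ∪
          (({x.1} : Finset (Vertex L)) ×ˢ Tv).map ⟨Sum.inr, Sum.inr_injective⟩).card := card_le_card hsub
    _ ≤ ((A ×ˢ Th).map ⟨Sum.inl, Sum.inl_injective⟩).card +
          ((({x.1} : Finset (Vertex L)) ×ˢ Tv).map ⟨Sum.inr, Sum.inr_injective⟩).card := card_union_le _ _
    _ = A.card * Th.card + 1 * Tv.card := by
        rw [card_map, card_map, card_product, card_product, card_singleton]
    _ ≤ 4 * 1 + 1 * 2 := by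
        apply Nat.add_le_add
        · exact Nat.mul_le_mul hA4 hTh1
        · exact Nat.mul_le_mul_left 1 hTv2
    _ = 6 := by norm_num

omit [NeZero L] in
/-- The projection evaluated on a link: `Π(E)(ℓ) = Σ_t E(ℓ, t)`. [cite: DennisEtAl2002, §6.1 (the projected chain Π)] -/
theorem proj_apply (E : History L T) (ℓ : Edge L) :
    E.proj ℓ = ∑ t : Fin T, E (Sum.inl (ℓ, t)) := by
  simp only [History.proj, Finset.sum_apply, History.slice]

/-- **The projection does not increase the number of links**: `‖Π(E)‖ ≤ ‖E‖` (a link of `Π(E)` is a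
horizontal link of `E` in at least one slice). [cite: DennisEtAl2002, §6.1 (Π(E))] -/
theorem hammingNorm_proj_le (E : History L T) : hammingNorm E.proj ≤ hammingNorm E := by
  classical
  have h1 : hammingNorm E.proj = (supp E.proj).card := rfl
  have h2 : hammingNorm E = (supp E).card := rfl
  rw [h1, h2]
  -- choose, for every link of the projection, a slice in which it is faulty
  have hex : ∀ ℓ ∈ supp E.proj, ∃ t : Fin T, E (Sum.inl (ℓ, t)) ≠ 0 := by
    intro ℓ hℓ
    have h : E.proj ℓ ≠ 0 := by simpa [supp] using hℓ
    rw [proj_apply] at h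
    obtain ⟨t, -, ht⟩ := Finset.exists_ne_zero_of_sum_ne_zero h
    exact ⟨t, ht⟩
  rcases Nat.eq_zero_or_pos T with hT0 | hTpos
  · -- no rounds: the projection is `0`
    subst hT0
    have hempty : supp E.proj = ∅ := by
      rw [Finset.eq_empty_iff_forall_notMem]
      intro ℓ hℓ
      obtain ⟨t, -⟩ := hex ℓ hℓ
      exact Fin.elim0 t
    rw [hempty, card_empty]
    exact Nat.zero_le _
  haveI : Nonempty (Fin T) := ⟨⟨0, hTpos⟩⟩
  choose! f hf using hex
  refine Finset.card_le_card_of_injOn (fun ℓ => (Sum.inl (ℓ, f ℓ) : STLink L T)) ?_ ?_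
  · intro ℓ hℓ
    have : E (Sum.inl (ℓ, f ℓ)) ≠ 0 := hf ℓ (Finset.mem_coe.1 hℓ)
    simpa [supp] using this
  · intro ℓ₁ _ ℓ₂ _ h
    have h' := Sum.inl_injective h
    exact (Prod.mk.inj h').1

/-- The syndrome map of the toric code is additive (used slice by slice). [cite: DennisEtAl2002, §4.3 (∂ is linear)] -/
private theorem syn_sum (f : Fin T → Chain L) (s : Vertex L) :
    syn L (∑ t, f t) s = ∑ t, syn L (f t) s := by
  unfold syn
  rw [Matrix.mulVec_sum, Finset.sum_apply]

/-- **The projection of a space-time cycle is a cycle of the toric code**: summing the space-time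
boundary `∂E(s, τ)` over all slices `τ` at a fixed site `s`, every vertical link is counted twice and the
horizontal links give `∂Π(E)(s)`; so `∂E = 0` forces `∂Π(E) = 0` ("The chain … can be projected onto the
final time slice"; a closed space-time chain projects to a closed chain).
[cite: DennisEtAl2002, §6.1 (projection onto the final time slice) with §4.3 (cycles)] -/
theorem proj_mem_cycles {E : History L T} (hE : E ∈ stCycles L T) : E.proj ∈ cycles L := by
  classical
  change syn L E.proj = 0
  funext s
  rw [Pi.zero_apply]
  have hzero : ∀ τ : Fin (T + 1), stSyn L T E (s, τ) = 0 := by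
    intro τ
    have h : stSyn L T E = 0 := hE
    rw [h]
    rfl
  have hsum : ∑ τ : Fin (T + 1), stSyn L T E (s, τ) = 0 := Finset.sum_eq_zero fun τ _ => hzero τ
  -- evaluate the same sum by `stSyn_apply`
  have hhor : ∀ t : Fin T,
      (∑ τ : Fin (T + 1), if τ = t.castSucc then syn L (E.slice t) s else 0) = syn L (E.slice t) s := by
    intro t
    rw [Finset.sum_ite_eq' univ (t.castSucc) (fun _ => syn L (E.slice t) s)]
    simp
  have hver : ∀ t : Fin T,
      (∑ τ : Fin (T + 1), if τ = t.castSucc ∨ τ = t.succ then E.meas t s else 0) = 0 := by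
    intro t
    have hne : t.castSucc ≠ t.succ := (Fin.castSucc_lt_succ (i := t)).ne
    have hset : univ.filter (fun τ : Fin (T + 1) => τ = t.castSucc ∨ τ = t.succ) = {t.castSucc, t.succ} := by
      ext τ
      simp [Finset.mem_filter]
    rw [← Finset.sum_filter, hset, Finset.sum_pair hne]
    generalize E.meas t s = c
    revert c
    decide
  have hexp : ∑ τ : Fin (T + 1), stSyn L T E (s, τ) = syn L E.proj s := by
    simp only [stSyn_apply]
    rw [Finset.sum_add_distrib, Finset.sum_comm, Finset.sum_congr rfl fun t _ => hhor t]
    rw [Finset.sum_comm, Finset.sum_congr rfl fun t _ => hver t, Finset.sum_const_zero, add_zero]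
    rw [History.proj, syn_sum]
  rw [← hexp, hsum]

variable (L T) in
/-- The projection as a linear map `History L T →ₗ Chain L` (a sum of coordinate slices).
[cite: DennisEtAl2002, §6.1 (Π)] -/
def projLinear : History L T →ₗ[ZMod 2] Chain L where
  toFun := History.proj
  map_add' E E' := by
    funext ℓ
    rw [Pi.add_apply, proj_apply, proj_apply, proj_apply, ← Finset.sum_add_distrib]
    rfl
  map_smul' c E := by
    funext ℓ
    rw [RingHom.id_apply, Pi.smul_apply, proj_apply, proj_apply, smul_eq_mul, Finset.mul_sum]
    rfl

variable (L T) in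
/-- The harmless histories as a SUBSPACE: the preimage of the boundaries under the projection (needed
to apply the irreducible-cluster decomposition, which splits off trivial parts inside a subspace).
[cite: DennisEtAl2002, §4.3 (homologically trivial cycles form the stabilizer) with §6.1 (Π)] -/
def stTrivialSubmodule : Submodule (ZMod 2) (History L T) :=
  (rowSpace (plaquetteMatrix L)).comap (projLinear L T)

/-- The subspace `stTrivialSubmodule` has the harmless histories `stTrivial` as its underlying set.
[cite: DennisEtAl2002, §4.3 with §6.1] -/
theorem coe_stTrivialSubmodule :
    (stTrivialSubmodule L T : Set (History L T)) = stTrivial L T := by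
  ext E
  rfl

/-- **Space-time distance `≥ L`**: a space-time cycle whose projection is homologically non-trivial has
at least `L` links — its projection is a non-trivial cycle of the toric code (`proj_mem_cycles`), which
has `≥ L` links (`cycle_weight_ge_holds`: "the homologically nontrivial … path must contain at least `L`
horizontal links"), and projecting does not increase the number of links.
[cite: DennisEtAl2002, §5.2 (at least L horizontal links)] -/
theorem le_hammingNorm_of_stCycle_not_trivial {E : History L T}
    (hE : stMatrix L T *ᵥ E = 0) (hES : E ∉ stTrivialSubmodule L T) : L ≤ hammingNorm E := by
  have hc : E.proj ∈ cycles L := proj_mem_cycles hE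
  have hnb : E.proj ∉ boundaries L := hES
  exact (cycle_weight_ge_holds L E.proj hc hnb).trans (hammingNorm_proj_le E)

/-- The number of space-time links: `2L²T` horizontal and `L²T` vertical ones, `n_ST = 3L²T`.
[cite: DennisEtAl2002, §4.2 (horizontal and vertical links of the T time slices)] -/
theorem card_stLink : (Fintype.card (STLink L T) : ℝ) = 3 * (L : ℝ) ^ 2 * T := by
  have hV : Fintype.card (Vertex L) = L ^ 2 := by
    simp [Vertex, TorusSite, ZMod.card, Fintype.card_fin]
  have h : Fintype.card (STLink L T) = 2 * L ^ 2 * T + L ^ 2 * T := by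
    simp only [Fintype.card_sum, Fintype.card_prod, Fintype.card_fin, hV]
    ring
  rw [h]
  push_cast
  ring

/-! ### The unconditional threshold -/

/-- **The cluster-counting bound for the `T`-round memory experiment, finite size** (UNCONDITIONAL,
kernel): for the `L × L` toric code (`L ≥ 1`), any number of rounds `T`, any minimum-weight space-time
decoder, and `q = p` with `0 ≤ p ≤ 1/2`, `r := 10 √(p(1-p)) < 1`:
`Prob_fail ≤ 3L²T · r^L / (5 (1 - r))` — DKP15's bound with `w = 6` (space-time star checks) and distance
`L`. [cite: DumerKovalevPryadko2015, Thm 3 (mechanism: w → w+2; here CSS one type, Thm 2 at y = 0 with w = 6)] -/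
theorem phenomFailureProb_le_cluster (D : STDecoder L T)
    (hD : D.IsMinWeight (stSyn L T) (stCycles L T) hammingNorm) {p : ℝ} (hp0 : 0 ≤ p) (hp : p ≤ 1 / 2)
    (hr : 10 * Real.sqrt (p * (1 - p)) < 1) :
    phenomFailureProb L T D p p ≤
      3 * (L : ℝ) ^ 2 * T * (10 * Real.sqrt (p * (1 - p))) ^ L / (5 * (1 - 10 * Real.sqrt (p * (1 - p)))) := by
  classical
  have hL1 : 1 ≤ L := Nat.one_le_iff_ne_zero.2 (NeZero.ne L)
  -- the failure sum in the generic vocabulary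
  have hD' : D.IsMinWeight (fun e : History L T => stMatrix L T *ᵥ e) {x | stMatrix L T *ᵥ x = 0} hammingNorm :=
    hD
  have hd : ∀ x : History L T, stMatrix L T *ᵥ x = 0 → x ∉ stTrivialSubmodule L T → L ≤ hammingNorm x :=
    fun x hx hxS => le_hammingNorm_of_stCycle_not_trivial hx hxS
  have hr' : 2 * ((6 - 1 : ℕ) : ℝ) * Real.sqrt (p * (1 - p)) < 1 := by
    norm_num
    linarith
  have hmain := sum_not_corrects_bernoulli_le_of_rowWeight (stMatrix L T) (stTrivialSubmodule L T) hD'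
    (w := 6) (by norm_num) card_rowSupp_stMatrix_le hL1 hd hp0 hp hr'
  -- identify the two failure sums
  have hsame : phenomFailureProb L T D p p =
      ∑ e ∈ univ.filter (fun e : History L T =>
        ¬ D.Corrects (fun e => stMatrix L T *ᵥ e) (stTrivialSubmodule L T : Set (History L T)) e),
        bernoulliWeight p (supp e) := by
    unfold phenomFailureProb
    refine Finset.sum_congr ?_ fun E _ => phenomenologicalWeight_self T p (supp E)
    ext E
    simp only [mem_filter, mem_univ, true_and, coe_stTrivialSubmodule]
    rfl
  rw [hsame]
  refine hmain.trans (le_of_eq ?_)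
  rw [card_stLink]
  have h5 : ((6 - 1 : ℕ) : ℝ) = 5 := by norm_num
  rw [h5]
  ring

/-- **Unconditional threshold for the toric code with noisy measurement, `q = p`, minimum-weight
space-time decoding**: for every polynomially bounded number of rounds `T(L)`, every family of
minimum-weight space-time decoders of the `(L+1) × (L+1)` toric codes and every `0 ≤ p ≤ 1/2` with
`100 p(1-p) < 1` (`p < (5 - 2√6)/10 ≈ .0101`), the failure probability tends to `0` — the `ν = 5` instance of
`phenomThreshold_of_sawCountBound`, PROVED without that hypothesis (kernel axioms).
[cite: DennisEtAl2002, §5.3 eqs. (saw_d) (d = 3: 6·5^{ℓ-1}), (threshold_iso), (fail_iso)] -/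
theorem phenomThreshold_cluster (T : ℕ → ℕ) (hT : IsPolyBounded T) (D : (L : ℕ) → STDecoder (L + 1) (T L))
    (hD : ∀ L, (D L).IsMinWeight (stSyn (L + 1) (T L)) (stCycles (L + 1) (T L)) hammingNorm)
    {p : ℝ} (hp0 : 0 ≤ p) (hp : p ≤ 1 / 2) (h100 : 100 * (p * (1 - p)) < 1) :
    Tendsto (fun L => phenomFailureProb (L + 1) (T L) (D L) p p) atTop (𝓝 0) := by
  set s : ℝ := Real.sqrt (p * (1 - p)) with hs
  set r : ℝ := 10 * s with hr
  have hs0 : 0 ≤ s := Real.sqrt_nonneg _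
  have hr0 : 0 ≤ r := by positivity
  have hpp : 0 ≤ p * (1 - p) := mul_nonneg hp0 (by linarith)
  have hr1 : r < 1 := by
    have hsq : r ^ 2 = 100 * (p * (1 - p)) := by
      rw [hr, mul_pow, hs, Real.sq_sqrt hpp]
      ring
    have h : r ^ 2 < 1 := by rw [hsq]; exact h100
    have := (sq_lt_one_iff_abs_lt_one r).1 h
    rwa [abs_of_nonneg hr0] at this
  have h1r : 0 < 1 - r := by linarith
  have hp1 : p ≤ 1 := by linarith
  obtain ⟨A, k, hAk⟩ := hT
  have hA0 : 0 ≤ A := by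
    have h := hAk 0
    simp only [Nat.cast_zero, zero_add, one_pow, mul_one] at h
    exact le_trans (Nat.cast_nonneg _) h
  -- the finite-size bound at every size, then the polynomial bound on `T`
  have hbound : ∀ L : ℕ, phenomFailureProb (L + 1) (T L) (D L) p p ≤
      3 * A * (((L : ℝ) + 1) ^ (k + 2) * r ^ (L + 1)) / (5 * (1 - r)) := by
    intro L
    have h := phenomFailureProb_le_cluster (L := L + 1) (T := T L) (D L) (hD L) hp0 hp hr1
    refine h.trans ?_
    have hTL := hAk L
    have hnum : 3 * ((L + 1 : ℕ) : ℝ) ^ 2 * (T L : ℝ) * r ^ (L + 1) ≤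
        3 * A * (((L : ℝ) + 1) ^ (k + 2) * r ^ (L + 1)) := by
      have hrp : 0 ≤ r ^ (L + 1) := pow_nonneg hr0 _
      have hL2 : 0 ≤ ((L : ℝ) + 1) ^ 2 := by positivity
      push_cast
      calc 3 * ((L : ℝ) + 1) ^ 2 * (T L : ℝ) * r ^ (L + 1)
          ≤ 3 * ((L : ℝ) + 1) ^ 2 * (A * ((L : ℝ) + 1) ^ k) * r ^ (L + 1) := by
            apply mul_le_mul_of_nonneg_right _ hrp
            exact mul_le_mul_of_nonneg_left hTL (by positivity)
        _ = 3 * A * (((L : ℝ) + 1) ^ (k + 2) * r ^ (L + 1)) := by ring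
    exact div_le_div_of_nonneg_right hnum (by positivity)
  have hnonneg : ∀ L : ℕ, 0 ≤ phenomFailureProb (L + 1) (T L) (D L) p p := by
    intro L
    unfold phenomFailureProb
    refine Finset.sum_nonneg fun E _ => ?_
    rw [phenomenologicalWeight_self]
    exact bernoulliWeight_nonneg hp0 hp1 _
  have hlim : Tendsto (fun L : ℕ => 3 * A * (((L : ℝ) + 1) ^ (k + 2) * r ^ (L + 1)) / (5 * (1 - r)))
      atTop (𝓝 0) := by
    have h0 := tendsto_pow_const_mul_const_pow_of_abs_lt_one (k + 2)
      (show |r| < 1 by rwa [abs_of_nonneg hr0])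
    have h1 : Tendsto (fun L : ℕ => ((L + 1 : ℕ) : ℝ) ^ (k + 2) * r ^ (L + 1)) atTop (𝓝 0) :=
      (Filter.tendsto_add_atTop_iff_nat 1).2 h0
    have h2 := (h1.const_mul (3 * A)).div_const (5 * (1 - r))
    rw [mul_zero, zero_div] at h2
    refine h2.congr fun L => ?_
    push_cast
    ring
  exact squeeze_zero hnonneg hbound hlim

end ToricCode

end Literature.InformationTheory.QuantumCodes
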